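import Literature.AlgebraicGeometry.Resolution.PointBlowupMohBoundPrimePower
import Literature.AlgebraicGeometry.Resolution.PointBlowupResidueInequality
import Literature.AlgebraicGeometry.Resolution.CentreBlowupMohStability
import HarnessLib

/-!
# The first two point blow-ups from a boundary-free state at order `pᵉ`: no increase of the shade
# at the first, and the localisation / size of a possible increase at the second

Topic: `Literature/AlgebraicGeometry/Resolution`. Corollaries (cell `res-hironaka`, D-0130 RESCUE,
menu M88 «growth bias e ≥ 2», engine seat res-D-pv-008; HOME/STATUS 2026-08-27T15:0xZ) of the
necessary conditions for an increase of the shade typed in `PointBlowupMohBoundPrimePower.lean`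
(`PointBlowup.necessary_of_shadeIncreases_pow`, `PointBlowup.shade_step_le_add_of_choose_ne_zero`:
[HauserPerlega2019PRIMS, §3 Theorem (2), (7), (9), Comment (d)] / [Moh1987, §1] read in fixed
coordinates, every `e`, every dimension), for the situation in which the cell's explicit test bed
starts its runs: a CLEANED residual polynomial `F` of `x^{pᵉ} + F(y)` with NO exceptional divisor
through the point (`r = 0`, the bed's «Γ = ∅»).

## What is proved (model of `PointBlowupShade.lean`; every prime `p`, every `e`, every field `K` of
## characteristic `p`, every finite type `σ` of residual letters)

* `PointBlowup.not_shadeIncreases_of_r_eq_zero` / `shade_step_le_of_r_eq_zero` — **from a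
  boundary-free state the shade does not increase at the first point blow-up**, at ANY point `b` of
  the exceptional divisor of ANY chart `y_j`: an increase needs a LOST EXCEPTIONAL component
  (`necessary_of_shadeIncreases_pow` (iii)), and there is none. With `r = 0` the shade IS the order
  `o = ord₀ F`, so `shade(step) ≤ o` (`shade_step_le_order_of_r_eq_zero`); in the bed's words the
  residual order `d_res(X₁, P; {E₁})` never exceeds `d_res(X, 0; ∅)` at event 1.
* `PointBlowup.not_isKangarooPoint_of_r_eq_zero`, `not_isAntelopePoint_of_r_eq_zero` — no kangaroo
  point lies above a boundary-free point ([Hauser2010, §G]: an antelope point carries exceptional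
  components).
* `PointBlowup.step_r_of_r_eq_zero` — after that first blow-up the only exceptional component is the
  new one, `r′ = (o − q)·e_j`.
* `PointBlowup.second_step_of_shadeIncreases` — **localisation of the first possible increase**: if
  the shade increases at the SECOND blow-up (chart `y_{j′}`, point `b′` of the new exceptional
  divisor, order still `≥ q`), then `j′ ≠ j`, `b′_j ≠ 0` (the point lies OFF the strict transform of
  the first exceptional divisor `{y_j = 0}`), `q < o` (the first component has positive
  multiplicity) and `q ∣ ord₀ F′`.
* `PointBlowup.shade_second_step_le` — **size of that increase**: `shade″ ≤ shade′ + min(p^{e−1}, o − q)`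
  (the Hasse probe at the lost index `j`, slack `min(p^k, r′_j)` with `r′_j = o − q`); in
  particular no increase at the second blow-up either when `o = q`
  (`shade_second_step_le_of_order_eq`).

## Why the cell wants it (numbers, not adjectives)

Menu M88 asks for dim-4 nodes at `q = p^e`, `e ≥ 2`, exhibiting a «Moh-size» rise `+p^{e−1}` of the
residual order; the node search of res-rescue-bed-G1 (HOME/STATUS 2026-08-27T14:56:39Z) was
pre-registered with the statistic «rise at EVENT 1 from Γ = ∅», which these corollaries show to be
`≤ 0` identically; the first event at which a rise can occur is event 2, off the strict transform of
`E₁`, in a chart different from the first, by at most `min(p^{e−1}, ord₀F − q)` — for `q = 4` a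
rise `+2` needs `ord₀ F ≥ 6`. OURS reading of published theorems typed in the tree; nothing here is a
statement of [Hironaka2017]; no claim about resolution of singularities.
-/

noncomputable section

open MvPolynomial Finset

open scoped BigOperators

namespace Literature.AlgebraicGeometry.Resolution

open Literature.AlgebraicGeometry.Resolution.Hauser2010
open Literature.Barriers.ResolutionOfSingularities

namespace PointBlowup

section Main

variable {σ : Type*} {K : Type*} [Field K] [Fintype σ] [DecidableEq σ] [DecidableEq K]
variable (p : ℕ) [hp : Fact p.Prime] [CharP K p]

/-! ## 1. Event 1 from a boundary-free state: no increase -/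

omit [Fintype σ] [DecidableEq σ] [DecidableEq K] hp [CharP K p] in
/-- With no exceptional divisor (`r = 0`) the divisibility hypothesis `y^r ∣ F` is trivial
(private plumbing). [folklore] -/
private theorem r_le_of_r_eq_zero (s : State σ K) (hr0 : s.r = 0) :
    ∀ d ∈ s.F.support, s.r ≤ d := fun d _ => by
  rw [hr0]; exact bot_le

omit [Fintype σ] [DecidableEq σ] [DecidableEq K] hp [CharP K p] in
/-- With no exceptional divisor the shade is the order: `shade (F, 0) = ord₀ F`.
[cite: Hauser2010, §F (definition of the shade)] -/
theorem shade_of_r_eq_zero (s : State σ K) (hr0 : s.r = 0) : s.shade = ordZero s.F := by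
  unfold State.shade
  rw [hr0, map_zero, Nat.cast_zero, tsub_zero]

/-- **No increase of the shade at the first point blow-up from a boundary-free state**, at order
`q = pᵉ`, every `e`, every dimension: for a cleaned residual polynomial `F` of order `o ≥ q` with
`r = 0` (no exceptional component through the point) and ANY point `b` of the exceptional divisor
read in ANY chart `y_j`, `¬ ShadeIncreases q j b (F, 0)` — by
`necessary_of_shadeIncreases_pow` (iii) an increase loses an exceptional component `{y_i = 0}` with
`r_i ≥ 1`, and there is none. (Derived by the cell from [HauserPerlega2019PRIMS, §3 Theorem (7) and
Comment (d)]: "at least two components of `D` are lost" — impossible for `D = ∅`.)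
[cite: HauserPerlega2019PRIMS, §3 Theorem (7), Comment (d)] -/
theorem not_shadeIncreases_of_r_eq_zero {e : ℕ} (j : σ) (b : σ → K) (hbj : b j = 0)
    (s : State σ K) (hclean : deletePthPowers (p ^ e) s.F = s.F) {o : ℕ} (ho : ordZero s.F = o)
    (hqo : p ^ e ≤ o) (hr0 : s.r = 0) : ¬ ShadeIncreases (p ^ e) j b s := by
  intro hinc
  obtain ⟨-, -, i, -, -, hri, -⟩ :=
    necessary_of_shadeIncreases_pow p j b hbj s hclean ho hqo (r_le_of_r_eq_zero s hr0) hinc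
  exact hri (by rw [hr0, Finsupp.zero_apply])

/-- The same as an inequality: `shade(step q j b (F, 0)) ≤ shade (F, 0)`.
[cite: HauserPerlega2019PRIMS, §3 Theorem (7), Comment (d)] -/
theorem shade_step_le_of_r_eq_zero {e : ℕ} (j : σ) (b : σ → K) (hbj : b j = 0)
    (s : State σ K) (hclean : deletePthPowers (p ^ e) s.F = s.F) {o : ℕ} (ho : ordZero s.F = o)
    (hqo : p ^ e ≤ o) (hr0 : s.r = 0) : (step (p ^ e) j b s).shade ≤ s.shade :=
  not_lt.mp (not_shadeIncreases_of_r_eq_zero p j b hbj s hclean ho hqo hr0)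

/-- **Event 1 in the bed's words**: from `Γ = ∅` the residual order after the first point blow-up,
read with respect to the new exceptional component, is at most the order before:
`shade(step q j b (F, 0)) ≤ o = ord₀ F` at every point of `E₁` in every chart.
[cite: HauserPerlega2019PRIMS, §3 Theorem (7), Comment (d)] -/
theorem shade_step_le_order_of_r_eq_zero {e : ℕ} (j : σ) (b : σ → K) (hbj : b j = 0)
    (s : State σ K) (hclean : deletePthPowers (p ^ e) s.F = s.F) {o : ℕ} (ho : ordZero s.F = o)
    (hqo : p ^ e ≤ o) (hr0 : s.r = 0) : (step (p ^ e) j b s).shade ≤ o := by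
  have h := shade_step_le_of_r_eq_zero p j b hbj s hclean ho hqo hr0
  rwa [shade_of_r_eq_zero s hr0, ho] at h

/-- The hypothesis-light form: `F` cleaned, `r = 0`, order `≥ q` (possibly `F = 0`, the resolved
terminal state, where every shade is `⊤` and nothing increases).
[cite: HauserPerlega2019PRIMS, §3 Theorem (7), Comment (d)] -/
theorem not_shadeIncreases_of_r_eq_zero' {e : ℕ} (j : σ) (b : σ → K) (hbj : b j = 0)
    (s : State σ K) (hclean : deletePthPowers (p ^ e) s.F = s.F)
    (hord : ((p ^ e : ℕ) : ℕ∞) ≤ ordZero s.F) (hr0 : s.r = 0) : ¬ ShadeIncreases (p ^ e) j b s := by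
  by_cases hF : s.F = 0
  · -- terminal state: `shade = ⊤` before, so no strict increase is possible
    intro hinc
    unfold ShadeIncreases at hinc
    have htop : s.shade = ⊤ := by
      rw [shade_of_r_eq_zero s hr0, hF, ordZero_zero]
    rw [htop] at hinc
    exact not_top_lt hinc
  · have hne : ordZero s.F ≠ ⊤ := by
      unfold ordZero
      rw [Ne, MvPowerSeries.order_eq_top_iff, MvPolynomial.coe_eq_zero_iff]
      exact hF
    obtain ⟨o, ho'⟩ := WithTop.ne_top_iff_exists.mp hne
    have ho : ordZero s.F = o := ho'.symm
    have hqo : p ^ e ≤ o := by rw [ho] at hord; exact_mod_cast hord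
    exact not_shadeIncreases_of_r_eq_zero p j b hbj s hclean ho hqo hr0

/-- **No kangaroo point above a boundary-free point** ([Hauser2010, §G]: the kangaroo phenomenon
needs exceptional components through the antelope point — with `D = ∅` condition (3) of the
Kangaroo Theorem has nothing to act on), at any order `pᵉ`, in any dimension.
[cite: Hauser2010, §G (Kangaroo Theorem)] [cite: HauserPerlega2019PRIMS, §3 Theorem (7)] -/
theorem not_isKangarooPoint_of_r_eq_zero {e : ℕ} (j : σ) (b : σ → K)
    (s : State σ K) (hclean : deletePthPowers (p ^ e) s.F = s.F)
    (hord : ((p ^ e : ℕ) : ℕ∞) ≤ ordZero s.F) (hr0 : s.r = 0) : ¬ IsKangarooPoint (p ^ e) j b s :=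
  fun hK => not_shadeIncreases_of_r_eq_zero' p j b hK.1 s hclean hord hr0 hK.2.2

/-- Hence a boundary-free point is never an antelope point. [cite: Hauser2010, §G (antelope points)] -/
theorem not_isAntelopePoint_of_r_eq_zero {e : ℕ} (s : State σ K)
    (hclean : deletePthPowers (p ^ e) s.F = s.F) (hord : ((p ^ e : ℕ) : ℕ∞) ≤ ordZero s.F)
    (hr0 : s.r = 0) : ¬ IsAntelopePoint (p ^ e) s := by
  rintro ⟨j, b, hK⟩
  exact not_isKangarooPoint_of_r_eq_zero p j b s hclean hord hr0 hK

/-! ## 2. The state after event 1: one exceptional component, multiplicity `o − q` -/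

omit [Fintype σ] hp [CharP K p] in
/-- After the first point blow-up from a boundary-free state of order `o`, read in the chart `y_j`
at a point `b` of the exceptional divisor, the exceptional multiplicities are `r′ = (o − q)·e_j`:
the only exceptional component is the new one `{y_j = 0}`.
[cite: Hauser2010, §F (transform D' of the exceptional divisor)] -/
theorem step_r_of_r_eq_zero (q : ℕ) (j : σ) (b : σ → K) (hbj : b j = 0) (s : State σ K)
    {o : ℕ} (ho : ordZero s.F = o) (hr0 : s.r = 0) :
    (step q j b s).r = Finsupp.single j (o - q) := by
  change newMult q j b s = _
  rw [newMult_eq q j b hbj s ho, hr0, Finsupp.zero_update,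
    Finsupp.filter_single_of_pos (fun i : σ => b i = 0) hbj]

/-! ## 3. Event 2: where an increase can happen, and by how much -/

/-- **Localisation of the first possible increase.** From a boundary-free cleaned state `(F, 0)` of
order `o ≥ q = pᵉ`, blow up the origin (chart `y_j`, point `b ∈ E₁`) and then the new point (chart
`y_{j′}`, point `b′ ∈ E₂`, order of the new residual polynomial `o₁ ≥ q`). If the shade increases at
this SECOND blow-up then: the second chart differs from the first (`j′ ≠ j`), the point lies OFF the
strict transform of the first exceptional divisor (`b′_j ≠ 0`), the first exceptional multiplicity
is positive (`q < o`), and `q ∣ o₁` — all read off `necessary_of_shadeIncreases_pow` (i), (iii) at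
the second step, the only exceptional component being `{y_j = 0}` with `r′_j = o − q`
(`step_r_of_r_eq_zero`). (Derived by the cell.)
[cite: HauserPerlega2019PRIMS, §3 Theorem (2), (7), Comment (d)] -/
theorem second_step_of_shadeIncreases {e : ℕ} (j : σ) (b : σ → K) (hbj : b j = 0)
    (s : State σ K) {o : ℕ} (ho : ordZero s.F = o) (hqo : p ^ e ≤ o) (hr0 : s.r = 0) (j' : σ) (b' : σ → K) (hbj' : b' j' = 0) {o₁ : ℕ}
    (ho₁ : ordZero (step (p ^ e) j b s).F = o₁) (hqo₁ : p ^ e ≤ o₁)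
    (hinc : ShadeIncreases (p ^ e) j' b' (step (p ^ e) j b s)) :
    j' ≠ j ∧ b' j ≠ 0 ∧ p ^ e < o ∧ p ^ e ∣ o₁ := by
  set s₁ := step (p ^ e) j b s with hs₁
  have hclean₁ : deletePthPowers (p ^ e) s₁.F = s₁.F := deletePthPowers_step (p ^ e) j b s
  have hr₁ : ∀ d ∈ s₁.F.support, s₁.r ≤ d :=
    newMult_le_of_mem_support_step (p ^ e) j b hbj s ho (r_le_of_r_eq_zero s hr0)
  have hr₁eq : s₁.r = Finsupp.single j (o - p ^ e) := step_r_of_r_eq_zero (p ^ e) j b hbj s ho hr0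
  obtain ⟨hdvd, -, i, hij', hbi, hri, -⟩ :=
    necessary_of_shadeIncreases_pow p j' b' hbj' s₁ hclean₁ ho₁ hqo₁ hr₁ hinc
  rw [hr₁eq, Finsupp.single_apply] at hri
  have hij : i = j := by
    by_contra hne
    exact hri (if_neg (Ne.symm hne))
  subst hij
  rw [if_pos rfl] at hri
  refine ⟨Ne.symm hij', hbi, ?_, hdvd⟩
  omega

/-- **Size of the first possible increase: `shade″ ≤ shade′ + min(p^{e−1}, o − q)`.** In the
situation of `second_step_of_shadeIncreases` (without assuming an increase), the shade after the
second blow-up exceeds the shade after the first by at most `min(p^{e−1}, o − q)`: if it increases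
at all, some initial monomial of the (cleaned) intermediate residual polynomial `F′` has its
`y_j`-exponent not divisible by `q` (all other old letters being untranslated or non-exceptional,
`necessary_of_shadeIncreases_pow` (ii), and `F′` having no `q`-th power monomial), and the Hasse
probe `shade_step_le_add_of_choose_ne_zero` at the lost index `j` has slack
`min(p^k, r′_j) ≤ min(p^{e−1}, o − q)`. (Derived by the cell; Moh's `+p^{e−1}` capped by the only
available exceptional multiplicity.)
[cite: HauserPerlega2019PRIMS, §3 Theorem (9) and §5 (proof, assertion (9))]
[cite: Moh1987, Stability Theorem (one permissible blow-up)] -/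
theorem shade_second_step_le {e : ℕ} (j : σ) (b : σ → K) (hbj : b j = 0)
    (s : State σ K) {o : ℕ} (ho : ordZero s.F = o) (hqo : p ^ e ≤ o) (hr0 : s.r = 0) (j' : σ) (b' : σ → K) (hbj' : b' j' = 0) {o₁ : ℕ}
    (ho₁ : ordZero (step (p ^ e) j b s).F = o₁) (hqo₁ : p ^ e ≤ o₁) :
    (step (p ^ e) j' b' (step (p ^ e) j b s)).shade
      ≤ (step (p ^ e) j b s).shade + ((min (p ^ (e - 1)) (o - p ^ e) : ℕ) : ℕ∞) := by
  set s₁ := step (p ^ e) j b s with hs₁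
  by_cases hinc : ShadeIncreases (p ^ e) j' b' s₁
  swap
  · exact le_trans (not_lt.mp hinc) le_self_add
  have hclean₁ : deletePthPowers (p ^ e) s₁.F = s₁.F := deletePthPowers_step (p ^ e) j b s
  have hr₁ : ∀ d ∈ s₁.F.support, s₁.r ≤ d :=
    newMult_le_of_mem_support_step (p ^ e) j b hbj s ho (r_le_of_r_eq_zero s hr0)
  have hr₁eq : s₁.r = Finsupp.single j (o - p ^ e) := step_r_of_r_eq_zero (p ^ e) j b hbj s ho hr0
  obtain ⟨hjj', -, -, hdvd⟩ :=
    second_step_of_shadeIncreases p j b hbj s ho hqo hr0 j' b' hbj' ho₁ hqo₁ hinc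
  obtain ⟨-, hii, -⟩ := necessary_of_shadeIncreases_pow p j' b' hbj' s₁ hclean₁ ho₁ hqo₁ hr₁ hinc
  -- an initial monomial of `F′`; it is not a `q`-th power, and every old letter other than `y_j`
  -- is non-exceptional, so its `y_j`-exponent is not divisible by `q`
  obtain ⟨⟨d₀, hd₀, hd₀deg⟩, -⟩ := (ordZero_eq_nat_iff _ _).mp ho₁
  have hd₀s : d₀ ∈ s₁.F.support := MvPolynomial.mem_support_iff.mpr hd₀
  have hnp := not_isPthPowerExponent_of_clean (p ^ e) hclean₁ hd₀s
  obtain ⟨i, hij', hndvd⟩ := exists_ne_not_dvd (p ^ e) j' (hd₀deg.symm ▸ hdvd) hnp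
  have hij : i = j := by
    by_contra hne
    refine hndvd (hii i hij' (Or.inr ?_) d₀ hd₀s hd₀deg)
    rw [hr₁eq, Finsupp.single_apply, if_neg (Ne.symm hne)]
  subst hij
  obtain ⟨k, hk, hk0⟩ := exists_natCast_choose_prime_pow_ne_zero p K hndvd
  have h := shade_step_le_add_of_choose_ne_zero p j' b' hbj' s₁ ho₁ hqo₁ hr₁ hij' hk hd₀s hd₀deg hk0
  refine le_trans h (add_le_add le_rfl ?_)
  have hrj : s₁.r i = o - p ^ e := by rw [hr₁eq, Finsupp.single_apply, if_pos rfl]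
  rw [hrj]
  have hk' : p ^ k ≤ p ^ (e - 1) := Nat.pow_le_pow_right hp.out.pos (by omega)
  exact_mod_cast min_le_min hk' le_rfl

/-- **In particular: starting at order exactly `q` there is no increase at the second blow-up
either** (`o = q ⇒ r′ = 0`: the state after event 1 is again boundary-free in the model).
[cite: HauserPerlega2019PRIMS, §3 Theorem (7), Comment (d)] -/
theorem shade_second_step_le_of_order_eq {e : ℕ} (j : σ) (b : σ → K) (hbj : b j = 0)
    (s : State σ K) (ho : ordZero s.F = (p ^ e : ℕ)) (hr0 : s.r = 0) (j' : σ) (b' : σ → K) (hbj' : b' j' = 0) {o₁ : ℕ}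
    (ho₁ : ordZero (step (p ^ e) j b s).F = o₁) (hqo₁ : p ^ e ≤ o₁) :
    (step (p ^ e) j' b' (step (p ^ e) j b s)).shade ≤ (step (p ^ e) j b s).shade := by
  have h := shade_second_step_le p j b hbj s ho le_rfl hr0 j' b' hbj' ho₁ hqo₁
  rwa [Nat.sub_self, Nat.min_zero, Nat.cast_zero, add_zero] at h

/-- **The two-event bound from a boundary-free start**: `shade″ ≤ o + min(p^{e−1}, o − q)` where
`o = ord₀ F` is the order (= shade) at the start. [cite: HauserPerlega2019PRIMS, §3 Theorem (7), (9)] -/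
theorem shade_second_step_le_order_add {e : ℕ} (j : σ) (b : σ → K) (hbj : b j = 0)
    (s : State σ K) (hclean : deletePthPowers (p ^ e) s.F = s.F) {o : ℕ} (ho : ordZero s.F = o)
    (hqo : p ^ e ≤ o) (hr0 : s.r = 0) (j' : σ) (b' : σ → K) (hbj' : b' j' = 0) {o₁ : ℕ}
    (ho₁ : ordZero (step (p ^ e) j b s).F = o₁) (hqo₁ : p ^ e ≤ o₁) :
    (step (p ^ e) j' b' (step (p ^ e) j b s)).shade
      ≤ (o : ℕ∞) + ((min (p ^ (e - 1)) (o - p ^ e) : ℕ) : ℕ∞) :=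
  le_trans (shade_second_step_le p j b hbj s ho hqo hr0 j' b' hbj' ho₁ hqo₁)
    (add_le_add (shade_step_le_order_of_r_eq_zero p j b hbj s hclean ho hqo hr0) le_rfl)

end Main

section Main2

variable {σ : Type*} {K : Type*} [Field K] [Fintype σ] [DecidableEq σ] [DecidableEq K]
variable (p : ℕ) [hp : Fact p.Prime] [CharP K p]

/-! ## 4. The sharp form: no increase at event 2 either; the first possible increase is at event 3 -/

omit [Fintype σ] [DecidableEq σ] [DecidableEq K] hp [CharP K p] in
/-- With no exceptional divisor (`r = 0`) the divisibility hypothesis `y^r ∣ F` is trivial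
(private plumbing, second copy for this section). [folklore] -/
private theorem r_le_of_r_eq_zero₂ (s : State σ K) (hr0 : s.r = 0) :
    ∀ d ∈ s.F.support, s.r ≤ d := fun d _ => by
  rw [hr0]; exact bot_le

/-- **No increase at the SECOND point blow-up from a boundary-free state** (every `e ≥ 1`, every
dimension, every chart `y_{j′}` and point `b′` at which the order is still `≥ q`): after the first
blow-up the only exceptional component is the new one, so at most ONE multiplicity is `≢ 0 (mod q)`,
and an increase needs TWO lost components with multiplicities `≢ 0 (mod q)`
(`not_shadeIncreases_of_card_le_one` ← [HauserPerlega2019PRIMS, §3 Comment (d)]; [HauserPerlega2024,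
p. 777] "the increase can only happen if `E_a` has two components and both are lost"). This sharpens
`shade_second_step_le` of §3 (whose bound `min(p^{e−1}, o − q)` is therefore never attained with a
positive value). (Derived by the cell.)
[cite: HauserPerlega2019PRIMS, §3 Theorem (6) and Comment (d)] [cite: HauserPerlega2024, §4 p. 777] -/
theorem not_shadeIncreases_second_step_of_r_eq_zero {e : ℕ} (he : 1 ≤ e) (j : σ) (b : σ → K)
    (hbj : b j = 0) (s : State σ K) {o : ℕ} (ho : ordZero s.F = o) (hr0 : s.r = 0)
    (j' : σ) (b' : σ → K) (hbj' : b' j' = 0) {o₁ : ℕ}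
    (ho₁ : ordZero (step (p ^ e) j b s).F = o₁) (hqo₁ : p ^ e ≤ o₁) :
    ¬ ShadeIncreases (p ^ e) j' b' (step (p ^ e) j b s) := by
  set s₁ := step (p ^ e) j b s with hs₁
  have hclean₁ : deletePthPowers (p ^ e) s₁.F = s₁.F := deletePthPowers_step (p ^ e) j b s
  have hr₁ : ∀ d ∈ s₁.F.support, s₁.r ≤ d :=
    newMult_le_of_mem_support_step (p ^ e) j b hbj s ho (r_le_of_r_eq_zero₂ s hr0)
  have hr₁eq : s₁.r = Finsupp.single j (o - p ^ e) := step_r_of_r_eq_zero (p ^ e) j b hbj s ho hr0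
  refine not_shadeIncreases_of_card_le_one p he j' b' hbj' s₁ hclean₁ ho₁ hqo₁ hr₁ ?_
  refine Finset.card_le_one.mpr fun i₁ hi₁ i₂ hi₂ => ?_
  rw [Finset.mem_filter, hr₁eq, Finsupp.single_apply] at hi₁ hi₂
  have h1 : j = i₁ := by
    by_contra hne; rw [if_neg hne] at hi₁; exact hi₁.2 (dvd_zero _)
  have h2 : j = i₂ := by
    by_contra hne; rw [if_neg hne] at hi₂; exact hi₂.2 (dvd_zero _)
  rw [← h1, ← h2]

/-- The same as an inequality: from a boundary-free start, `shade″ ≤ shade′` at the second point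
blow-up. [cite: HauserPerlega2019PRIMS, §3 Theorem (6) and Comment (d)] -/
theorem shade_second_step_le_shade {e : ℕ} (he : 1 ≤ e) (j : σ) (b : σ → K)
    (hbj : b j = 0) (s : State σ K) {o : ℕ} (ho : ordZero s.F = o) (hr0 : s.r = 0)
    (j' : σ) (b' : σ → K) (hbj' : b' j' = 0) {o₁ : ℕ}
    (ho₁ : ordZero (step (p ^ e) j b s).F = o₁) (hqo₁ : p ^ e ≤ o₁) :
    (step (p ^ e) j' b' (step (p ^ e) j b s)).shade ≤ (step (p ^ e) j b s).shade :=
  not_lt.mp (not_shadeIncreases_second_step_of_r_eq_zero p he j b hbj s ho hr0 j' b' hbj' ho₁ hqo₁)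

omit [Fintype σ] hp [CharP K p] in
/-- The exceptional multiplicities after TWO point blow-ups from a boundary-free state: the second
new component `{y_{j₂} = 0}` has `o₁ − q`; the first one `{y_{j₁} = 0}` survives with `o − q` iff
the second blow-up is read in another chart (`j₂ ≠ j₁`) at a point ON it (`b₂_{j₁} = 0`); every
other multiplicity is `0`. [cite: Hauser2010, §F (transform D' of the exceptional divisor)] -/
theorem step_step_r_apply_of_r_eq_zero (q : ℕ) (s : State σ K) (hr0 : s.r = 0) {o : ℕ}
    (ho : ordZero s.F = o) (j₁ : σ) (b₁ : σ → K) (hb₁ : b₁ j₁ = 0) {o₁ : ℕ}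
    (ho₁ : ordZero (step q j₁ b₁ s).F = o₁) (j₂ : σ) (b₂ : σ → K) (hb₂ : b₂ j₂ = 0) (i : σ) :
    (step q j₂ b₂ (step q j₁ b₁ s)).r i =
      if i = j₂ then o₁ - q else if i = j₁ ∧ b₂ j₁ = 0 then o - q else 0 := by
  have h1 : (step q j₁ b₁ s).r = Finsupp.single j₁ (o - q) := step_r_of_r_eq_zero q j₁ b₁ hb₁ s ho hr0
  change newMult q j₂ b₂ (step q j₁ b₁ s) i = _
  rw [newMult_eq q j₂ b₂ hb₂ _ ho₁, h1, Finsupp.filter_apply, Finsupp.update_apply, Finsupp.single_apply]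
  by_cases hij₂ : i = j₂
  · subst hij₂; simp [hb₂]
  · rw [if_neg hij₂, if_neg hij₂]
    by_cases hij₁ : i = j₁
    · subst hij₁
      by_cases hb : b₂ i = 0
      · simp [hb]
      · simp [hb]
    · have : ¬ (j₁ = i) := fun h => hij₁ h.symm
      simp [this, hij₁]

/-- **Localisation of the first possible increase from a boundary-free start: EVENT 3.** Blow up the
origin of a boundary-free state `(F, 0)` of order `o ≥ q = pᵉ` (`e ≥ 1`), chart `y_{j₁}`, point
`b₁`; then the new point (order `o₁ ≥ q`), chart `y_{j₂}`, point `b₂`; then the new point (order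
`o₂ ≥ q`), chart `y_{j₃}`, point `b₃`. If the shade increases at this THIRD blow-up then:
the first two blow-ups were read in DIFFERENT charts (`j₁ ≠ j₂`) with the second point ON the
strict transform of the first exceptional divisor (`b₂_{j₁} = 0`), BOTH multiplicities `o − q` and
`o₁ − q` are `≢ 0 (mod q)` (equivalently `q ∤ o`, `q ∤ o₁`), the third point LOSES BOTH components
(`j₁ = j₃ ∨ b₃_{j₁} ≠ 0`, and `j₂ = j₃ ∨ b₃_{j₂} ≠ 0`), and `q ∣ o₂`. (Derived by the cell from
`exists_two_lost_of_shadeIncreases` and `necessary_of_shadeIncreases_pow` (i): the only candidates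
for the two lost components are the two created so far.)
[cite: HauserPerlega2019PRIMS, §3 Theorem (2), (6) and Comment (d)] -/
theorem third_step_of_shadeIncreases {e : ℕ} (he : 1 ≤ e) (s : State σ K) (hr0 : s.r = 0) {o : ℕ}
    (ho : ordZero s.F = o)
    (j₁ : σ) (b₁ : σ → K) (hb₁ : b₁ j₁ = 0) {o₁ : ℕ} (ho₁ : ordZero (step (p ^ e) j₁ b₁ s).F = o₁)
    (j₂ : σ) (b₂ : σ → K) (hb₂ : b₂ j₂ = 0) {o₂ : ℕ}
    (ho₂ : ordZero (step (p ^ e) j₂ b₂ (step (p ^ e) j₁ b₁ s)).F = o₂) (hqo₂ : p ^ e ≤ o₂)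
    (j₃ : σ) (b₃ : σ → K) (hb₃ : b₃ j₃ = 0)
    (hinc : ShadeIncreases (p ^ e) j₃ b₃ (step (p ^ e) j₂ b₂ (step (p ^ e) j₁ b₁ s))) :
    j₁ ≠ j₂ ∧ b₂ j₁ = 0 ∧ ¬ p ^ e ∣ o - p ^ e ∧ ¬ p ^ e ∣ o₁ - p ^ e ∧
      (j₁ = j₃ ∨ b₃ j₁ ≠ 0) ∧ (j₂ = j₃ ∨ b₃ j₂ ≠ 0) ∧ p ^ e ∣ o₂ := by
  classical
  set q := p ^ e with hq
  set s₁ := step q j₁ b₁ s with hs₁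
  set s₂ := step q j₂ b₂ s₁ with hs₂
  have hr₁ : ∀ d ∈ s₁.F.support, s₁.r ≤ d :=
    newMult_le_of_mem_support_step q j₁ b₁ hb₁ s ho (r_le_of_r_eq_zero₂ s hr0)
  have hclean₂ : deletePthPowers q s₂.F = s₂.F := deletePthPowers_step q j₂ b₂ s₁
  have hr₂ : ∀ d ∈ s₂.F.support, s₂.r ≤ d := newMult_le_of_mem_support_step q j₂ b₂ hb₂ s₁ ho₁ hr₁
  have hr₂i : ∀ i, s₂.r i = if i = j₂ then o₁ - q else if i = j₁ ∧ b₂ j₁ = 0 then o - q else 0 :=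
    step_step_r_apply_of_r_eq_zero q s hr0 ho j₁ b₁ hb₁ ho₁ j₂ b₂ hb₂
  obtain ⟨i₁, i₂, hne, hl₁, hl₂, hd₁, hd₂⟩ :=
    exists_two_lost_of_shadeIncreases p he j₃ b₃ hb₃ s₂ hclean₂ ho₂ hqo₂ hr₂ hinc
  obtain ⟨hdvd, -, -⟩ := necessary_of_shadeIncreases_pow p j₃ b₃ hb₃ s₂ hclean₂ ho₂ hqo₂ hr₂ hinc
  -- each of `i₁, i₂` is `j₂` (second multiplicity) or `j₁` kept at the second step (first multiplicity)
  have key : ∀ i, ¬ q ∣ s₂.r i →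
      (i = j₂ ∧ ¬ q ∣ o₁ - q) ∨ (i = j₁ ∧ i ≠ j₂ ∧ b₂ j₁ = 0 ∧ ¬ q ∣ o - q) := by
    intro i hi
    rw [hr₂i i] at hi
    by_cases hij₂ : i = j₂
    · rw [if_pos hij₂] at hi; exact Or.inl ⟨hij₂, hi⟩
    · rw [if_neg hij₂] at hi
      by_cases hc : i = j₁ ∧ b₂ j₁ = 0
      · rw [if_pos hc] at hi; exact Or.inr ⟨hc.1, hij₂, hc.2, hi⟩
      · rw [if_neg hc] at hi; exact absurd (dvd_zero _) hi
  rcases key i₁ hd₁ with ⟨h1j, h1d⟩ | ⟨h1j, h1ne, h1b, h1d⟩ <;>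
    rcases key i₂ hd₂ with ⟨h2j, h2d⟩ | ⟨h2j, h2ne, h2b, h2d⟩
  · exact absurd (h1j.trans h2j.symm) hne
  · subst h1j; subst h2j
    exact ⟨h2ne, h2b, h2d, h1d, hl₂, hl₁, hdvd⟩
  · subst h1j; subst h2j
    exact ⟨h1ne, h1b, h1d, h2d, hl₁, hl₂, hdvd⟩
  · exact absurd (h1j.trans h2j.symm) hne

/-- In particular, **if `q ∣ o` (the first exceptional multiplicity `o − q` is a multiple of `q`) there
is no increase at event 3 either** from a boundary-free start. [cite: HauserPerlega2019PRIMS, §3 Theorem (6) and Comment (d)] -/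
theorem not_shadeIncreases_third_step_of_dvd {e : ℕ} (he : 1 ≤ e) (s : State σ K) (hr0 : s.r = 0)
    {o : ℕ} (ho : ordZero s.F = o) (hdvd : p ^ e ∣ o)
    (j₁ : σ) (b₁ : σ → K) (hb₁ : b₁ j₁ = 0) {o₁ : ℕ} (ho₁ : ordZero (step (p ^ e) j₁ b₁ s).F = o₁)
    (j₂ : σ) (b₂ : σ → K) (hb₂ : b₂ j₂ = 0) {o₂ : ℕ}
    (ho₂ : ordZero (step (p ^ e) j₂ b₂ (step (p ^ e) j₁ b₁ s)).F = o₂) (hqo₂ : p ^ e ≤ o₂)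
    (j₃ : σ) (b₃ : σ → K) (hb₃ : b₃ j₃ = 0) :
    ¬ ShadeIncreases (p ^ e) j₃ b₃ (step (p ^ e) j₂ b₂ (step (p ^ e) j₁ b₁ s)) := by
  intro hinc
  obtain ⟨-, -, hndvd, -⟩ :=
    third_step_of_shadeIncreases p he s hr0 ho j₁ b₁ hb₁ ho₁ j₂ b₂ hb₂ ho₂ hqo₂ j₃ b₃ hb₃ hinc
  exact hndvd (Nat.dvd_sub hdvd dvd_rfl)

/-- **Size of the first possible increase (event 3): `shade‴ ≤ shade″ + min(p^{e−1}, max(o − q, o₁ − q))`**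
— Moh's `+p^{e−1}` capped by the larger of the two exceptional multiplicities created so far (the
Hasse probe `shade_step_le_add_of_choose_ne_zero` at the lost exceptional index carrying an initial
exponent not divisible by `q`, slack `min(p^k, r_i)`). (Derived by the cell.)
[cite: HauserPerlega2019PRIMS, §3 Theorem (9) and §5 (proof, assertion (9))]
[cite: Moh1987, Stability Theorem (one permissible blow-up)] -/
theorem shade_third_step_le {e : ℕ} (he : 1 ≤ e) (s : State σ K) (hr0 : s.r = 0) {o : ℕ}
    (ho : ordZero s.F = o)
    (j₁ : σ) (b₁ : σ → K) (hb₁ : b₁ j₁ = 0) {o₁ : ℕ} (ho₁ : ordZero (step (p ^ e) j₁ b₁ s).F = o₁)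
    (j₂ : σ) (b₂ : σ → K) (hb₂ : b₂ j₂ = 0) {o₂ : ℕ}
    (ho₂ : ordZero (step (p ^ e) j₂ b₂ (step (p ^ e) j₁ b₁ s)).F = o₂) (hqo₂ : p ^ e ≤ o₂)
    (j₃ : σ) (b₃ : σ → K) (hb₃ : b₃ j₃ = 0) :
    (step (p ^ e) j₃ b₃ (step (p ^ e) j₂ b₂ (step (p ^ e) j₁ b₁ s))).shade
      ≤ (step (p ^ e) j₂ b₂ (step (p ^ e) j₁ b₁ s)).shade
        + ((min (p ^ (e - 1)) (max (o - p ^ e) (o₁ - p ^ e)) : ℕ) : ℕ∞) := by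
  classical
  set q := p ^ e with hq
  set s₁ := step q j₁ b₁ s with hs₁
  set s₂ := step q j₂ b₂ s₁ with hs₂
  by_cases hinc : ShadeIncreases q j₃ b₃ s₂
  swap
  · exact le_trans (not_lt.mp hinc) le_self_add
  have hr₁ : ∀ d ∈ s₁.F.support, s₁.r ≤ d :=
    newMult_le_of_mem_support_step q j₁ b₁ hb₁ s ho (r_le_of_r_eq_zero₂ s hr0)
  have hclean₂ : deletePthPowers q s₂.F = s₂.F := deletePthPowers_step q j₂ b₂ s₁
  have hr₂ : ∀ d ∈ s₂.F.support, s₂.r ≤ d := newMult_le_of_mem_support_step q j₂ b₂ hb₂ s₁ ho₁ hr₁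
  have hr₂i : ∀ i, s₂.r i = if i = j₂ then o₁ - q else if i = j₁ ∧ b₂ j₁ = 0 then o - q else 0 :=
    step_step_r_apply_of_r_eq_zero q s hr0 ho j₁ b₁ hb₁ ho₁ j₂ b₂ hb₂
  -- the lost exceptional index with an initial exponent not divisible by `q`
  obtain ⟨-, -, i₀, hi₀, -, hri₀, d₀, hd₀, hd₀deg, hndvd⟩ :=
    necessary_of_shadeIncreases_pow p j₃ b₃ hb₃ s₂ hclean₂ ho₂ hqo₂ hr₂ hinc
  obtain ⟨k, hk, hk0⟩ := exists_natCast_choose_prime_pow_ne_zero p K hndvd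
  have h := shade_step_le_add_of_choose_ne_zero p j₃ b₃ hb₃ s₂ ho₂ hqo₂ hr₂ hi₀ hk hd₀ hd₀deg hk0
  refine le_trans h (add_le_add le_rfl ?_)
  have hk' : p ^ k ≤ p ^ (e - 1) := Nat.pow_le_pow_right hp.out.pos (by omega)
  have hrle : s₂.r i₀ ≤ max (o - q) (o₁ - q) := by
    rw [hr₂i i₀]
    split_ifs
    · exact le_max_right _ _
    · exact le_max_left _ _
    · exact Nat.zero_le _
  exact_mod_cast min_le_min hk' hrle

end Main2

end PointBlowup

namespace CentreBlowup

section BoundaryFree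

variable {σ : Type*} {K : Type*} [Field K] [Fintype σ] [DecidableEq σ] [DecidableEq K]
variable (p : ℕ) [hp : Fact p.Prime] [CharP K p]

/-! ## 5. Centres of any dimension: from a boundary-free point the first two blow-ups in
Moh-permissible coordinate centres never raise the shade (transfer from the point case) -/

omit [Fintype σ] [DecidableEq σ] in
/-- `degIn S 0 = 0` (private plumbing). [folklore] -/
private theorem degIn_zero_bf (S : Finset σ) : degIn S (0 : σ →₀ ℕ) = 0 := by
  simp [degIn]

omit [Fintype σ] [DecidableEq σ] [DecidableEq K] hp [CharP K p] in
/-- With no exceptional divisor the Moh-permissibility of `C_S` for `(F, 0)` of order `o` reads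
`o ≤ degIn S d` for every monomial `y^d` of `F` (`C_S` lies in the `o`-fold locus of the residual
factor `F` itself) (private plumbing). [cite: Moh1987, p. 967 (Definition of a permissible center, (3))] -/
private theorem perm_of_r_eq_zero (S : Finset σ) (s : CState σ K) (hr0 : s.r = 0) {o : ℕ}
    (hperm : ∀ d ∈ s.F.support, o ≤ degIn S d) :
    ∀ d ∈ s.F.support, degIn S s.r + (o - s.r.degree) ≤ degIn S d := by
  intro d hd
  rw [hr0, degIn_zero_bf, map_zero, Nat.sub_zero, zero_add]
  exact hperm d hd

/-- **Event 1 under a permissible coordinate centre of ANY dimension, from a boundary-free point: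
no increase.** For a cleaned boundary-free state `(F, 0)` of order `o ≥ q = pᵉ` and a coordinate
centre `C_S` (`j ∈ S`) that is Moh-permissible for it (`o ≤ degIn S d` for every monomial of `F`:
`C_S` inside the `o`-fold locus), at every point `b` of the fibre of the blow-up over the origin
(`b_j = 0`, `b_i = 0` off `S`): `shade(CentreBlowup.step q S j b s) ≤ shade s` — by the transfer
`shade_step_le_shade_pointStep` (the centre step is dominated by the point step with the same chart
and point) and `PointBlowup.shade_step_le_of_r_eq_zero`. (Derived by the cell.)
[cite: Moh1987, Stability Theorem (permissible blow-ups)] [cite: HauserPerlega2019PRIMS, §3 Theorem (7), Comment (d)] -/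
theorem shade_step_le_of_r_eq_zero {e : ℕ} {S : Finset σ} {j : σ} (hj : j ∈ S) (b : σ → K)
    (hbj : b j = 0) (hbN : ∀ i, i ∉ S → b i = 0) (s : CState σ K)
    (hclean : deletePthPowers (p ^ e) s.F = s.F) {o : ℕ} (ho : ordZero s.F = o) (hqo : p ^ e ≤ o)
    (hr0 : s.r = 0) (hperm : ∀ d ∈ s.F.support, o ≤ degIn S d) :
    (step (p ^ e) S j b s).shade ≤ s.shade := by
  have hr : ∀ d ∈ s.F.support, s.r ≤ d := fun d _ => by rw [hr0]; exact bot_le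
  have hperm' := perm_of_r_eq_zero S s hr0 hperm
  have hq : ∀ d ∈ s.F.support, p ^ e ≤ degIn S d := fun d hd => le_trans hqo (hperm d hd)
  refine le_trans (shade_step_le_shade_pointStep (p ^ e) hj b hbj hbN s ho hr hq hperm') ?_
  rw [← CState.shade_toState]
  exact PointBlowup.shade_step_le_of_r_eq_zero p j b hbj s.toState hclean ho hqo hr0

omit hp [CharP K p] in
/-- After a permissible `C_S`-step from a boundary-free state the multiplicities are `(o − q)·e_j`.
[cite: Hauser2010, §F (transform D')] -/
theorem step_r_of_r_eq_zero (q : ℕ) (S : Finset σ) (j : σ) (b : σ → K) (hbj : b j = 0)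
    (s : CState σ K) {o : ℕ} (ho : ordZero s.F = o) (hr0 : s.r = 0)
    (hperm : ∀ d ∈ s.F.support, o ≤ degIn S d) :
    (step q S j b s).r = Finsupp.single j (o - q) := by
  have hr : ∀ d ∈ s.F.support, s.r ≤ d := fun d _ => by rw [hr0]; exact bot_le
  rw [step_r_eq q S j b hbj s ho hr (perm_of_r_eq_zero S s hr0 hperm), hr0, degIn_zero_bf, map_zero,
    Nat.sub_zero, zero_add, Finsupp.zero_update, Finsupp.filter_single_of_pos (fun i : σ => b i = 0) hbj]

/-- **Event 2 under permissible coordinate centres of ANY dimensions, from a boundary-free point: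
no increase either** (`e ≥ 1`). First a Moh-permissible `C_{S₁}`-step (chart `j₁ ∈ S₁`, point `b₁`
of the fibre over the origin) of the cleaned boundary-free state `(F, 0)` of order `o`; then, at the
new point, a `C_{S₂}`-step (`j₂ ∈ S₂`, point `b₂` of the fibre) which is Moh-permissible for the new
state (`C_{S₂}` in its `q`-fold locus and in the equimultiple locus of its residual factor). The shade
does not increase: the second step is dominated by the point step (`shade_step_le_shade_pointStep`),
and the intermediate state has exactly one exceptional component, so the point step cannot increase
(`PointBlowup.not_shadeIncreases_of_card_le_one` ← [HauserPerlega2019PRIMS, Comment (d)]).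
(Derived by the cell: whatever permissible coordinate centres an order-driven rule picks, the first
two blow-ups from a boundary-free point never raise the residual order, at any order `pᵉ`.)
[cite: Moh1987, Stability Theorem (permissible blow-ups)] [cite: HauserPerlega2019PRIMS, §3 Theorem (6) and Comment (d)] -/
theorem shade_step_step_le_of_r_eq_zero {e : ℕ} (he : 1 ≤ e)
    {S₁ : Finset σ} {j₁ : σ} (b₁ : σ → K) (hb₁ : b₁ j₁ = 0)
    (s : CState σ K) {o : ℕ} (ho : ordZero s.F = o) (hr0 : s.r = 0)
    (hperm₁ : ∀ d ∈ s.F.support, o ≤ degIn S₁ d)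
    {S₂ : Finset σ} {j₂ : σ} (hj₂ : j₂ ∈ S₂) (b₂ : σ → K) (hb₂ : b₂ j₂ = 0)
    (hb₂N : ∀ i, i ∉ S₂ → b₂ i = 0) {o₁ : ℕ} (ho₁ : ordZero (step (p ^ e) S₁ j₁ b₁ s).F = o₁)
    (hq₂ : ∀ d ∈ (step (p ^ e) S₁ j₁ b₁ s).F.support, p ^ e ≤ degIn S₂ d)
    (hperm₂ : ∀ d ∈ (step (p ^ e) S₁ j₁ b₁ s).F.support,
      degIn S₂ (step (p ^ e) S₁ j₁ b₁ s).r + (o₁ - (step (p ^ e) S₁ j₁ b₁ s).r.degree) ≤ degIn S₂ d) :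
    (step (p ^ e) S₂ j₂ b₂ (step (p ^ e) S₁ j₁ b₁ s)).shade ≤ (step (p ^ e) S₁ j₁ b₁ s).shade := by
  classical
  set q := p ^ e with hq
  set s₁ := step q S₁ j₁ b₁ s with hs₁
  have hr : ∀ d ∈ s.F.support, s.r ≤ d := fun d _ => by rw [hr0]; exact bot_le
  have hr₁ : ∀ d ∈ s₁.F.support, s₁.r ≤ d :=
    newMult_le_of_mem_support_step q S₁ j₁ b₁ hb₁ s ho hr (perm_of_r_eq_zero S₁ s hr0 hperm₁)
  have hclean₁ : deletePthPowers q s₁.F = s₁.F := deletePthPowers_step q S₁ j₁ b₁ s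
  have hr₁eq : s₁.r = Finsupp.single j₁ (o - q) := step_r_of_r_eq_zero q S₁ j₁ b₁ hb₁ s ho hr0 hperm₁
  obtain ⟨hqo₁, -, -⟩ := le_of_forall_le_degIn S₂ s₁ ho₁ hr₁ hperm₂ hq₂
  refine le_trans (shade_step_le_shade_pointStep q hj₂ b₂ hb₂ hb₂N s₁ ho₁ hr₁ hq₂ hperm₂) ?_
  rw [← CState.shade_toState]
  refine not_lt.mp (PointBlowup.not_shadeIncreases_of_card_le_one p he j₂ b₂ hb₂ s₁.toState hclean₁
    ho₁ hqo₁ hr₁ ?_)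
  refine Finset.card_le_one.mpr fun i₁ hi₁ i₂ hi₂ => ?_
  have e₁ : s₁.toState.r = Finsupp.single j₁ (o - q) := hr₁eq
  rw [Finset.mem_filter, e₁, Finsupp.single_apply] at hi₁ hi₂
  have h1 : j₁ = i₁ := by
    by_contra hne; rw [if_neg hne] at hi₁; exact hi₁.2 (dvd_zero _)
  have h2 : j₁ = i₂ := by
    by_contra hne; rw [if_neg hne] at hi₂; exact hi₂.2 (dvd_zero _)
  rw [← h1, ← h2]

end BoundaryFree

end CentreBlowup

end Literature.AlgebraicGeometry.Resolution

end
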